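import Literature.LinearAlgebra.Matrix.IntegerSymplecticInvolutionNormalForm
import Literature.LinearAlgebra.Matrix.IntegerSymmetricModTwoTypeCongruence
import HarnessLib

/-!
# Goresky–Tai 2017, Proposition 50 (third assertion): the `Sp_{2n}(ℤ)`-conjugacy classes of integral
# symplectic involutions of multiplier `−1` — a complete invariant, and their number `⌊3n/2⌋ + 1`

Goresky–Tai, *Real structures on ordinary abelian varieties*, arXiv:1701.07742, Appendix §20.6 p0047–p0048
(verbatim):

> «**Proposition 50.** Let `R` be an integral domain containing `½`. Then `H¹(⟨τ₀⟩, Sp_{2n}(R))` is trivial.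
> If `2|N` the mapping `H¹(⟨τ₀⟩, K⁰_N) → H¹(⟨τ₀⟩, Sp_{2n}(ℤ))` is trivial.  The cohomology sets
> `H¹(⟨τ₀⟩, Sp_{2n}(ℤ)) ≅ H¹(⟨τ₀⟩, Sp_{2n}(ℤ̂)) ≅ H¹(⟨τ₀⟩, Sp_{2n}(ℤ₂))` are isomorphic and have order
> `(3n+1)/2` if `n` is odd, or `(3n+2)/2` if `n` is even.»
> Proof (last paragraph): «The cohomology set `H¹(⟨τ₀⟩, Sp_{2n}(ℤ))` is finite because it may be identified
> with `Sp_{2n}(ℤ)`-conjugacy classes of involutions with multiplier `−1` which, by Lemma (lem-Z-involutions)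
> [Lemma 45] corresponds to `GL_n(ℤ)`-congruence classes of symmetric `n × n` matrices `B` consisting of
> zeroes and ones.  Summing over the possible ranks `0 ≤ r ≤ n` for the matrix `B`, with two possibilities
> when `r` is even and only one possibility when `r` is odd gives `(3n+1)/2` for `n` odd and `(3n+2)/2` for
> `n` even, cf. [Lidl].»

and §20.1 p0046 (the cohomology set): «For `g ∈ Sp(2n, R)` let `g̃ = τ₀gτ₀⁻¹`. … a 1-cocycle … `f(τ₀) = g`
where `gg̃ = I`. … two cocycles `f_g, f_{g′}` are cohomologous if there exists `h ∈ Γ` such that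
`g′ = h⁻¹gh̃` or equivalently, such that `g′ = h̃gh⁻¹`. … If `τ ∈ GSp_{2n}(R)` is another involution … with
multiplier equal to `−1` then `g = ττ₀` defines a cocycle since `gg̃ = 1`.»

## What is formalized (Mathlib conventions: `J = Matrix.J m ℤ = (0 −1; 1 0)`, `Sp = Matrix.symplecticGroup m ℤ`,
## multiplier `−1` as `ᵗτJτ = −J`; `u(S) = (1 S; 0 −1)`; `τ₀ = (−1 0; 0 1)`; «`S mod 2`» is `S.map (ℤ → ℤ/2)`)

The THIRD assertion of Proposition 50 at the level of `Sp_{2n}(ℤ)` (the counting), with the step the print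
leaves implicit — that `Sp_{2n}(ℤ)`-conjugacy classes of involutions «correspond» to congruence classes of
`B mod 2`, i.e. that conjugate normal forms `u(B) ∼ u(B′)` have congruent `B̄, B̄′` — supplied by two
explicit CONJUGACY INVARIANTS.  «`τ ∼ τ′`» (Sp-conjugate) is spelled `∃ g g′, g ∈ Sp ∧ gg′ = 1 ∧ gτg′ = τ′`,
as in the tree's Lemma 45 files; no definition is introduced.

* §1 (any commutative ring) `J_mul_upperInvolution` (`J·u(S) = (0 1; 1 S)`), `transpose_J_mul_eq` (for an
  involution `τ` of multiplier `−1` the matrix `Jτ` is SYMMETRIC — it is the Gram matrix of `𝔅₀(x, τy)`),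
  `J_mul_conj_eq` (`J·(gτg′) = ᵗg′(Jτ)g′` for `g ∈ Sp`, `gg′ = 1`: conjugating `τ` is a congruence of `Jτ`),
  `map_upperInvolution_sub_one` (`u(S) − 1 ≡ (0 S̄; 0 0) mod 2`), `rank_fromBlocks_zero₁₁_zero₂₁_zero₂₂`.
* §2 (over `ℤ`, any finite index) the two invariants: ★ `rank_map_conj_sub_one` — the `𝔽₂`-rank of `τ̄ − 1` is a
  conjugacy invariant (even under `GL_{2n}(ℤ)`), and on `u(S)` it is `rank S̄` (`rank_map_upperInvolution_sub_one`);
  ★ `forall_two_dvd_diag_J_mul_conj_iff` — the parity «all diagonal entries of `Jτ` are even» (i.e. the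
  symmetric form `𝔅₀(x, τx)` is even) is an `Sp_{2n}(ℤ)`-conjugacy invariant, and on `u(S)` it says «the
  diagonal of `S` is even», i.e. `S̄` is alternate (`forall_two_dvd_diag_J_mul_upperInvolution_iff`).
* §3 the conjugacy relation is an equivalence (`conj_refl`, `conj_symm`, `conj_trans`) and
  ★★ `upperInvolution_conj_iff` — for symmetric `S, S′ ∈ M_n(ℤ)`: `u(S) ∼ u(S′)` under `Sp_{2n}(ℤ)` IFF
  `rank S̄ = rank S̄′` and (`diag S` even ⟺ `diag S′` even) IFF `S, S′` are `GL_n(ℤ)`-congruent modulo `2`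
  («corresponds to `GL_n(ℤ)`-congruence classes of symmetric … matrices `B` consisting of zeroes and ones»;
  ⟸ is the tree's `exists_symplectic_conj_upperInvolution_of_congruent_mod_two` with Albert's classification,
  ⟹ is §2); ★★ `conj_iff_invariants_eq` — for two involutions of multiplier `−1` the pair
  (`rank(τ̄ − 1)`, parity of `diag(Jτ)`) is a COMPLETE `Sp_{2n}(ℤ)`-conjugacy invariant (with Lemma 45).
* §4 ★★★ `ncard_conjClasses` — the set of `Sp_{2n}(ℤ)`-conjugacy classes of involutions `τ ∈ M_{2n}(ℤ)`,
  `τ² = 1`, `ᵗτJτ = −J` (classes as subsets of `M_{2n}(ℤ)`) has exactly `n + 1 + ⌊n/2⌋` elements, and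
  `ncard_conjClasses_eq_printed`: this number is «`(3n+1)/2` if `n` is odd, or `(3n+2)/2` if `n` is even».
* §5 the dictionary with `H¹(⟨τ₀⟩, Sp_{2n}(ℤ))`: `tau0_*` (`τ₀² = 1`, `ᵗτ₀ = τ₀`, multiplier `−1`, `h̃ ∈ Sp`),
  `mul_tau0_mul_self_eq_one_iff` («`g = ττ₀` defines a cocycle since `gg̃ = 1`»), `mul_tau0_multiplier_iff`
  (`gτ₀` has multiplier `−1` iff `g ∈ Sp`), `cohomologyClass_eq_image_conjClass` (the class
  `{h̃gh⁻¹}` of the cocycle `g` is the conjugacy class of the involution `gτ₀`, translated by `τ₀`), and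
  ★★★ `ncard_cohomologyClasses` — `H¹(⟨τ₀⟩, Sp_{2n}(ℤ))`, realised as the set of classes
  `{h̃gh′ | h ∈ Sp_{2n}(ℤ), hh′ = 1}` of cocycles `g ∈ Sp_{2n}(ℤ)`, `gg̃ = 1`, has `n + 1 + ⌊n/2⌋` elements.

Scope.  Only `Sp_{2n}(ℤ)` is treated here (the first two assertions of Proposition 50 and the comparison with
`Sp_{2n}(ℤ̂)`, `Sp_{2n}(ℤ₂)` are not in this file).  THEOREMS ONLY; no definition, instance, notation or named
fact.

## References

* [GoreskyTai2017RealStructuresOrdinary] M. Goresky, Y.-S. Tai, *Real structures on ordinary abelian varieties*,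
  arXiv:1701.07742 (2017), Appendix §20.1 (cocycles, Prop. 47), §19.2 Lemma 45, §20.6 Proposition 50 and proof.
* [Silhol1989] R. Silhol, *Real Algebraic Surfaces*, LNM 1392 (1989), Ch. IV (4.3)–(4.5), Prop. (5.2) — the same
  count `n + 1 + ⌊n/2⌋` of types `(λ, α)` (tree `QuadraticForm.ncard_congruenceTypes`).
* [Albert1938] A. A. Albert, Trans. AMS 43 (1938), Thms. 3, 7 — symmetric matrices over `𝔽₂` up to congruence.
-/

noncomputable section

open Matrix

namespace Literature.LinearAlgebra.Matrix

namespace IntegerSymplecticInvolution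

/-! ## §1 Algebra over a commutative ring -/

section CommRing

variable {R : Type*} [CommRing R] {m : Type*} [Fintype m] [DecidableEq m]

/-- `J·u(S) = (0 1; 1 S)` — the Gram matrix of `(x, y) ↦ 𝔅₀(x, u(S)y)` (`J = (0 −1; 1 0)`).
[cite: GoreskyTai2017RealStructuresOrdinary, App. §19.2 Lemma 45 (the normal form `(I S; 0 −I)`)] -/
theorem J_mul_upperInvolution (S : Matrix m m R) :
    Matrix.J m R * fromBlocks (1 : Matrix m m R) S 0 (-1 : Matrix m m R) = fromBlocks 0 1 1 S := by
  rw [Matrix.J, fromBlocks_multiply]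
  simp

/-- For an involution `τ` of multiplier `−1` (`τ² = 1`, `ᵗτJτ = −J`) one has `ᵗτJ = −Jτ`.
[cite: GoreskyTai2017RealStructuresOrdinary, App. §19.1 (multiplier) and §20.1] -/
theorem transpose_mul_J_eq_neg (τ : Matrix (m ⊕ m) (m ⊕ m) R) (hττ : τ * τ = 1)
    (hJ : τᵀ * Matrix.J m R * τ = -Matrix.J m R) : τᵀ * Matrix.J m R = -(Matrix.J m R * τ) := by
  calc τᵀ * Matrix.J m R = τᵀ * Matrix.J m R * (τ * τ) := by rw [hττ, Matrix.mul_one]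
    _ = τᵀ * Matrix.J m R * τ * τ := by simp only [Matrix.mul_assoc]
    _ = -(Matrix.J m R * τ) := by rw [hJ, Matrix.neg_mul]

/-- **`Jτ` is symmetric** for an involution `τ` of multiplier `−1`: the bilinear form `𝔅₀(x, τy)` is
symmetric. [cite: GoreskyTai2017RealStructuresOrdinary, App. §19.1–§19.2 (involutions of multiplier `−1`)] -/
theorem transpose_J_mul_eq (τ : Matrix (m ⊕ m) (m ⊕ m) R) (hττ : τ * τ = 1)
    (hJ : τᵀ * Matrix.J m R * τ = -Matrix.J m R) : (Matrix.J m R * τ)ᵀ = Matrix.J m R * τ := by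
  rw [transpose_mul, Matrix.J_transpose, Matrix.mul_neg, transpose_mul_J_eq_neg τ hττ hJ, neg_neg]

/-- For `g ∈ Sp` with `gg′ = 1`: `ᵗgJ = Jg′` and `Jg = ᵗg′J`. [folklore] -/
private theorem J_mul_eq_transpose_mul_J {g g' : Matrix (m ⊕ m) (m ⊕ m) R} (hg : g ∈ Matrix.symplecticGroup m R)
    (hgg' : g * g' = 1) : Matrix.J m R * g = g'ᵀ * Matrix.J m R := by
  have h1 : gᵀ * Matrix.J m R * g = Matrix.J m R := SymplecticGroup.mem_iff'.1 hg
  have h2 : gᵀ * Matrix.J m R = Matrix.J m R * g' := by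
    calc gᵀ * Matrix.J m R = gᵀ * Matrix.J m R * (g * g') := by rw [hgg', Matrix.mul_one]
      _ = gᵀ * Matrix.J m R * g * g' := by simp only [Matrix.mul_assoc]
      _ = Matrix.J m R * g' := by rw [h1]
  have h3 := congrArg transpose h2
  rw [transpose_mul, transpose_transpose, Matrix.J_transpose, transpose_mul, Matrix.J_transpose,
    Matrix.mul_neg, Matrix.neg_mul, neg_inj] at h3
  exact h3

/-- **Conjugating `τ` by `g ∈ Sp` is a congruence of `Jτ`**: `J·(gτg′) = ᵗg′(Jτ)g′` (`gg′ = 1`) — the form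
`𝔅₀(x, τy)` is transported. [cite: GoreskyTai2017RealStructuresOrdinary, App. §20.6 Proposition 50 (proof, the
identification with conjugacy classes)] -/
theorem J_mul_conj_eq (τ : Matrix (m ⊕ m) (m ⊕ m) R) {g g' : Matrix (m ⊕ m) (m ⊕ m) R}
    (hg : g ∈ Matrix.symplecticGroup m R) (hgg' : g * g' = 1) :
    Matrix.J m R * (g * τ * g') = g'ᵀ * (Matrix.J m R * τ) * g' := by
  calc Matrix.J m R * (g * τ * g') = Matrix.J m R * g * τ * g' := by simp only [Matrix.mul_assoc]
    _ = g'ᵀ * Matrix.J m R * τ * g' := by rw [J_mul_eq_transpose_mul_J hg hgg']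
    _ = g'ᵀ * (Matrix.J m R * τ) * g' := by simp only [Matrix.mul_assoc]

/-- If `g ∈ Sp` and `gg′ = 1` then `g′ ∈ Sp`. [folklore] -/
private theorem mem_symplecticGroup_of_mul_eq_one' {g g' : Matrix (m ⊕ m) (m ⊕ m) R}
    (hg : g ∈ Matrix.symplecticGroup m R) (h : g * g' = 1) : g' ∈ Matrix.symplecticGroup m R := by
  have e : g' = -(Matrix.J m R * gᵀ * Matrix.J m R) := by
    calc g' = -(Matrix.J m R * gᵀ * Matrix.J m R * g) * g' := by
          rw [SymplecticGroup.inv_left_mul_aux hg, Matrix.one_mul]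
      _ = -(Matrix.J m R * gᵀ * Matrix.J m R) * (g * g') := by simp only [Matrix.neg_mul, Matrix.mul_assoc]
      _ = -(Matrix.J m R * gᵀ * Matrix.J m R) := by rw [h, Matrix.mul_one]
  rw [e]
  exact SymplecticGroup.neg_mem (Submonoid.mul_mem _ (Submonoid.mul_mem _ (SymplecticGroup.J_mem m R)
    (SymplecticGroup.transpose_mem hg)) (SymplecticGroup.J_mem m R))

end CommRing

/-! ### Reduction modulo `2` and a rank computation -/

section Rank

variable {K : Type*} [Field K] {m : Type*} [Fintype m] [DecidableEq m]

/-- `rank (0 B; 0 0) = rank B` (`(0 B; 0 0) = (1; 0)·B·(0 1)` and `B = (1 0)·(0 B; 0 0)·(0; 1)`). [folklore] -/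
private theorem rank_fromBlocks_zero₁₁_zero₂₁_zero₂₂ (B : Matrix m m K) :
    (fromBlocks (0 : Matrix m m K) B (0 : Matrix m m K) (0 : Matrix m m K)).rank = B.rank := by
  set L : Matrix (m ⊕ m) m K := fromRows (1 : Matrix m m K) (0 : Matrix m m K) with hL
  set R : Matrix m (m ⊕ m) K := fromCols (0 : Matrix m m K) (1 : Matrix m m K) with hR
  set L' : Matrix m (m ⊕ m) K := fromCols (1 : Matrix m m K) (0 : Matrix m m K) with hL'
  set R' : Matrix (m ⊕ m) m K := fromRows (0 : Matrix m m K) (1 : Matrix m m K) with hR'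
  have h1 : fromBlocks (0 : Matrix m m K) B (0 : Matrix m m K) (0 : Matrix m m K) = L * B * R := by
    rw [hL, hR, fromRows_mul, fromRows_mul_fromCols]
    simp
  have h2 : L' * fromBlocks (0 : Matrix m m K) B (0 : Matrix m m K) (0 : Matrix m m K) * R' = B := by
    rw [hL', hR', fromCols_mul_fromBlocks, fromCols_mul_fromRows]
    simp
  apply le_antisymm
  · calc (fromBlocks (0 : Matrix m m K) B (0 : Matrix m m K) (0 : Matrix m m K)).rank = (L * B * R).rank := by
          rw [← h1]
      _ ≤ (L * B).rank := Matrix.rank_mul_le_left _ _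
      _ ≤ B.rank := Matrix.rank_mul_le_right _ _
  · calc B.rank = (L' * fromBlocks (0 : Matrix m m K) B (0 : Matrix m m K) (0 : Matrix m m K) * R').rank := by
          rw [h2]
      _ ≤ (L' * fromBlocks (0 : Matrix m m K) B (0 : Matrix m m K) (0 : Matrix m m K)).rank :=
          Matrix.rank_mul_le_left _ _
      _ ≤ (fromBlocks (0 : Matrix m m K) B (0 : Matrix m m K) (0 : Matrix m m K)).rank :=
          Matrix.rank_mul_le_right _ _

end Rank

section ModTwo

variable {m : Type*} [Fintype m] [DecidableEq m]

omit [Fintype m] in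
/-- `u(S) − 1 ≡ (0 S̄; 0 0) (mod 2)` (`−2 ≡ 0`). [cite: GoreskyTai2017RealStructuresOrdinary, App. §20.6
Proposition 50 (proof, reduction modulo `2`)] -/
theorem map_upperInvolution_sub_one (S : Matrix m m ℤ) :
    (fromBlocks (1 : Matrix m m ℤ) S 0 (-1 : Matrix m m ℤ)).map (Int.castRingHom (ZMod 2)) - 1 =
      fromBlocks (0 : Matrix m m (ZMod 2)) (S.map (Int.castRingHom (ZMod 2))) (0 : Matrix m m (ZMod 2))
        (0 : Matrix m m (ZMod 2)) := by
  ext (i | i) (j | j)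
  · by_cases h : i = j
    · subst h; simp
    · simp [h]
  · simp
  · simp
  · by_cases h : i = j
    · subst h
      simp only [Matrix.sub_apply, Matrix.map_apply, fromBlocks_apply₂₂, Matrix.neg_apply, Matrix.one_apply_eq,
        map_neg, map_one, Matrix.zero_apply]
      decide
    · simp [h]

/-- `ḡ ḡ′ = 1`. [folklore] -/
private theorem map_mul_map_eq_one {N : Type*} [Fintype N] [DecidableEq N] {g g' : Matrix N N ℤ}
    (h : g * g' = 1) : g.map (Int.castRingHom (ZMod 2)) * g'.map (Int.castRingHom (ZMod 2)) = 1 := by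
  rw [← Matrix.map_mul, h, Matrix.map_one _ (map_zero _) (map_one _)]

/-- The reduction of an invertible integer matrix is invertible. [folklore] -/
private theorem isUnit_det_map {N : Type*} [Fintype N] [DecidableEq N] {g g' : Matrix N N ℤ}
    (h : g * g' = 1) : IsUnit (g.map (Int.castRingHom (ZMod 2))).det :=
  Matrix.isUnit_det_of_right_inverse (map_mul_map_eq_one h)

/-- The reduction of an invertible integer matrix is invertible (left version). [folklore] -/
private theorem isUnit_det_map' {N : Type*} [Fintype N] [DecidableEq N] {g g' : Matrix N N ℤ}
    (h : g * g' = 1) : IsUnit (g'.map (Int.castRingHom (ZMod 2))).det :=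
  Matrix.isUnit_det_of_left_inverse (map_mul_map_eq_one h)

/-- `(S̄)_{ii} = 0 ⟺ 2 ∣ S_{ii}`. [folklore] -/
private theorem map_apply_eq_zero_iff {N : Type*} (S : Matrix N N ℤ) (i j : N) :
    S.map (Int.castRingHom (ZMod 2)) i j = 0 ↔ (2 : ℤ) ∣ S i j := by
  rw [Matrix.map_apply, eq_intCast, ZMod.intCast_zmod_eq_zero_iff_dvd, Nat.cast_ofNat]

/-! ## §2 Two `Sp_{2n}(ℤ)`-conjugacy invariants of an involution of multiplier `−1` -/

/-- ★ **Invariant 1: the `𝔽₂`-rank of `τ̄ − 1`** is unchanged under conjugation by any `g ∈ GL_{2n}(ℤ)`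
(`gg′ = 1`): `(gτg′)‾ − 1 = ḡ(τ̄ − 1)ḡ′`. [cite: GoreskyTai2017RealStructuresOrdinary, App. §20.6 Proposition 50
(proof: conjugacy classes «correspond» to congruence classes — the rank `r` of `B`)] -/
theorem rank_map_conj_sub_one {N : Type*} [Fintype N] [DecidableEq N] (τ : Matrix N N ℤ) {g g' : Matrix N N ℤ}
    (hgg' : g * g' = 1) :
    ((g * τ * g').map (Int.castRingHom (ZMod 2)) - 1).rank = (τ.map (Int.castRingHom (ZMod 2)) - 1).rank := by
  have h1 : (g * τ * g').map (Int.castRingHom (ZMod 2)) - 1 =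
      g.map (Int.castRingHom (ZMod 2)) * (τ.map (Int.castRingHom (ZMod 2)) - 1) * g'.map (Int.castRingHom (ZMod 2)) := by
    rw [Matrix.mul_sub, Matrix.sub_mul, Matrix.mul_one, map_mul_map_eq_one hgg', Matrix.map_mul, Matrix.map_mul]
  rw [h1, Matrix.rank_mul_eq_left_of_isUnit_det _ _ (isUnit_det_map' hgg'),
    Matrix.rank_mul_eq_right_of_isUnit_det _ _ (isUnit_det_map hgg')]

/-- **Invariant 1 on the normal form: `rank(u(S)‾ − 1) = rank S̄`.**
[cite: GoreskyTai2017RealStructuresOrdinary, App. §20.6 Proposition 50 (proof: «the possible ranks `0 ≤ r ≤ n`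
for the matrix `B`»)] -/
theorem rank_map_upperInvolution_sub_one (S : Matrix m m ℤ) :
    ((fromBlocks (1 : Matrix m m ℤ) S 0 (-1 : Matrix m m ℤ)).map (Int.castRingHom (ZMod 2)) - 1).rank =
      (S.map (Int.castRingHom (ZMod 2))).rank := by
  rw [map_upperInvolution_sub_one, rank_fromBlocks_zero₁₁_zero₂₁_zero₂₂]

/-- ★ **Invariant 2: the parity of the diagonal of the symmetric matrix `Jτ`** (i.e. whether the form
`𝔅₀(x, τx)` takes only even values) is unchanged under conjugation of the involution `τ` (multiplier `−1`)
by `g ∈ Sp_{2n}(ℤ)`, `gg′ = 1`. [cite: GoreskyTai2017RealStructuresOrdinary, App. §20.6 Proposition 50 (proof: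
«two possibilities when `r` is even»); Albert1938, Thm. 7] -/
theorem forall_two_dvd_diag_J_mul_conj_iff (τ : Matrix (m ⊕ m) (m ⊕ m) ℤ) (hττ : τ * τ = 1)
    (hJ : τᵀ * Matrix.J m ℤ * τ = -Matrix.J m ℤ) {g g' : Matrix (m ⊕ m) (m ⊕ m) ℤ}
    (hg : g ∈ Matrix.symplecticGroup m ℤ) (hgg' : g * g' = 1) :
    (∀ i, (2 : ℤ) ∣ (Matrix.J m ℤ * (g * τ * g')) i i) ↔ ∀ i, (2 : ℤ) ∣ (Matrix.J m ℤ * τ) i i := by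
  rw [J_mul_conj_eq τ hg hgg']
  have hsym : ((Matrix.J m ℤ * τ).map (Int.castRingHom (ZMod 2)))ᵀ = (Matrix.J m ℤ * τ).map (Int.castRingHom (ZMod 2)) := by
    rw [← transpose_map, transpose_J_mul_eq τ hττ hJ]
  have key := QuadraticForm.diag_transpose_mul_mul_eq_zero_iff _ _ hsym (isUnit_det_map' hgg')
  have hm : (g'.map (Int.castRingHom (ZMod 2)))ᵀ * (Matrix.J m ℤ * τ).map (Int.castRingHom (ZMod 2)) *
      g'.map (Int.castRingHom (ZMod 2)) = (g'ᵀ * (Matrix.J m ℤ * τ) * g').map (Int.castRingHom (ZMod 2)) := by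
    rw [← transpose_map, ← Matrix.map_mul, ← Matrix.map_mul]
  rw [hm] at key
  simp only [map_apply_eq_zero_iff] at key
  exact key

/-- **Invariant 2 on the normal form**: the diagonal of `J·u(S) = (0 1; 1 S)` is even iff the diagonal of
`S` is even (`S̄` alternate: «`H ⊕ ⋯ ⊕ H ⊕ 0`» versus «`I_r ⊕ 0`»).
[cite: GoreskyTai2017RealStructuresOrdinary, App. §19.2 Lemma 45 and §20.6 Proposition 50 (proof)] -/
theorem forall_two_dvd_diag_J_mul_upperInvolution_iff (S : Matrix m m ℤ) :
    (∀ i, (2 : ℤ) ∣ (Matrix.J m ℤ * fromBlocks (1 : Matrix m m ℤ) S 0 (-1 : Matrix m m ℤ)) i i) ↔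
      ∀ i, (2 : ℤ) ∣ S i i := by
  rw [J_mul_upperInvolution]
  constructor
  · intro h i
    simpa only [fromBlocks_apply₂₂] using h (Sum.inr i)
  · rintro h (i | i)
    · simp only [fromBlocks_apply₁₁, Matrix.zero_apply, dvd_zero]
    · simpa only [fromBlocks_apply₂₂] using h i

/-! ## §3 The conjugacy relation; the classification of the normal forms `u(S)` -/

/-- `τ ∼ τ` (`g = g′ = 1`): `Sp_{2n}(ℤ)`-conjugacy is reflexive.
[cite: GoreskyTai2017RealStructuresOrdinary, App. §20.6 Proposition 50 (proof: «`Sp_{2n}(ℤ)`-conjugacy classes of involutions»)] -/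
theorem conj_refl (τ : Matrix (m ⊕ m) (m ⊕ m) ℤ) :
    ∃ g g' : Matrix (m ⊕ m) (m ⊕ m) ℤ, g ∈ Matrix.symplecticGroup m ℤ ∧ g * g' = 1 ∧ g * τ * g' = τ :=
  ⟨1, 1, Submonoid.one_mem _, Matrix.mul_one _, by rw [Matrix.one_mul, Matrix.mul_one]⟩

/-- `τ ∼ τ′ ⟹ τ′ ∼ τ` (`g′ ∈ Sp`, `g′g = 1`): `Sp_{2n}(ℤ)`-conjugacy is symmetric.
[cite: GoreskyTai2017RealStructuresOrdinary, App. §20.6 Proposition 50 (proof: «`Sp_{2n}(ℤ)`-conjugacy classes of involutions»)] -/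
theorem conj_symm {τ τ' : Matrix (m ⊕ m) (m ⊕ m) ℤ}
    (h : ∃ g g' : Matrix (m ⊕ m) (m ⊕ m) ℤ, g ∈ Matrix.symplecticGroup m ℤ ∧ g * g' = 1 ∧ g * τ * g' = τ') :
    ∃ g g' : Matrix (m ⊕ m) (m ⊕ m) ℤ, g ∈ Matrix.symplecticGroup m ℤ ∧ g * g' = 1 ∧ g * τ' * g' = τ := by
  obtain ⟨g, g', hg, hgg', rfl⟩ := h
  have hg'g : g' * g = 1 := mul_eq_one_comm.1 hgg'
  refine ⟨g', g, mem_symplecticGroup_of_mul_eq_one' hg hgg', hg'g, ?_⟩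
  calc g' * (g * τ * g') * g = g' * g * τ * (g' * g) := by simp only [Matrix.mul_assoc]
    _ = τ := by rw [hg'g, Matrix.one_mul, Matrix.mul_one]

/-- `τ ∼ τ′`, `τ′ ∼ τ″ ⟹ τ ∼ τ″` (products): `Sp_{2n}(ℤ)`-conjugacy is transitive.
[cite: GoreskyTai2017RealStructuresOrdinary, App. §20.6 Proposition 50 (proof: «`Sp_{2n}(ℤ)`-conjugacy classes of involutions»)] -/
theorem conj_trans {τ τ' τ'' : Matrix (m ⊕ m) (m ⊕ m) ℤ}
    (h : ∃ g g' : Matrix (m ⊕ m) (m ⊕ m) ℤ, g ∈ Matrix.symplecticGroup m ℤ ∧ g * g' = 1 ∧ g * τ * g' = τ')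
    (h' : ∃ g g' : Matrix (m ⊕ m) (m ⊕ m) ℤ, g ∈ Matrix.symplecticGroup m ℤ ∧ g * g' = 1 ∧ g * τ' * g' = τ'') :
    ∃ g g' : Matrix (m ⊕ m) (m ⊕ m) ℤ, g ∈ Matrix.symplecticGroup m ℤ ∧ g * g' = 1 ∧ g * τ * g' = τ'' := by
  obtain ⟨g, g', hg, hgg', rfl⟩ := h
  obtain ⟨k, k', hk, hkk', rfl⟩ := h'
  refine ⟨k * g, g' * k', Submonoid.mul_mem _ hk hg, ?_, by simp only [Matrix.mul_assoc]⟩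
  calc k * g * (g' * k') = k * (g * g') * k' := by simp only [Matrix.mul_assoc]
    _ = 1 := by rw [hgg', Matrix.mul_one, hkk']

/-- Conjugate matrices have equal `Sp_{2n}(ℤ)`-conjugacy classes.
[cite: GoreskyTai2017RealStructuresOrdinary, App. §20.6 Proposition 50 (proof: «`Sp_{2n}(ℤ)`-conjugacy classes of involutions»)] -/
theorem conjClass_eq_of_conj {τ τ' : Matrix (m ⊕ m) (m ⊕ m) ℤ}
    (h : ∃ g g' : Matrix (m ⊕ m) (m ⊕ m) ℤ, g ∈ Matrix.symplecticGroup m ℤ ∧ g * g' = 1 ∧ g * τ * g' = τ') :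
    {σ : Matrix (m ⊕ m) (m ⊕ m) ℤ | ∃ g g' : Matrix (m ⊕ m) (m ⊕ m) ℤ,
        g ∈ Matrix.symplecticGroup m ℤ ∧ g * g' = 1 ∧ g * τ * g' = σ} =
      {σ | ∃ g g' : Matrix (m ⊕ m) (m ⊕ m) ℤ, g ∈ Matrix.symplecticGroup m ℤ ∧ g * g' = 1 ∧ g * τ' * g' = σ} := by
  ext σ
  exact ⟨fun hσ => conj_trans (conj_symm h) hσ, fun hσ => conj_trans h hσ⟩

/-- The tree's Lemma 45 in the present orientation: every integral involution of multiplier `−1` is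
`Sp_{2n}(ℤ)`-conjugate (`gτg′`, `gg′ = 1`) to some `u(B)` with `B` symmetric.
[cite: GoreskyTai2017RealStructuresOrdinary, App. §19.2 Lemma 45] -/
theorem exists_conj_upperInvolution (τ : Matrix (m ⊕ m) (m ⊕ m) ℤ) (hττ : τ * τ = 1)
    (hJ : τᵀ * Matrix.J m ℤ * τ = -Matrix.J m ℤ) :
    ∃ B : Matrix m m ℤ, Bᵀ = B ∧ ∃ g g' : Matrix (m ⊕ m) (m ⊕ m) ℤ, g ∈ Matrix.symplecticGroup m ℤ ∧
      g * g' = 1 ∧ g * τ * g' = fromBlocks (1 : Matrix m m ℤ) B 0 (-1 : Matrix m m ℤ) := by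
  obtain ⟨g, g', B, -, hg', hg'g, hB, hconj⟩ := exists_symplectic_conj_eq_upperInvolution τ hττ hJ
  exact ⟨B, hB, g', g, hg', hg'g, hconj⟩

/-- An entrywise congruence modulo `2` of integer matrices is an equality of the reductions. [folklore] -/
private theorem map_eq_map_of_forall_intModEq {N : Type*} {X Y : Matrix N N ℤ} (h : ∀ i j, X i j ≡ Y i j [ZMOD 2]) :
    X.map (Int.castRingHom (ZMod 2)) = Y.map (Int.castRingHom (ZMod 2)) := by
  ext i j
  rw [Matrix.map_apply, Matrix.map_apply, eq_intCast, eq_intCast]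
  exact (ZMod.intCast_eq_intCast_iff _ _ 2).mpr (h i j)

/-- An equality of reductions modulo `2` is an entrywise congruence. [folklore] -/
private theorem forall_intModEq_of_map_eq_map {N : Type*} {X Y : Matrix N N ℤ}
    (h : X.map (Int.castRingHom (ZMod 2)) = Y.map (Int.castRingHom (ZMod 2))) (i j : N) : X i j ≡ Y i j [ZMOD 2] := by
  have hij := congr_fun (congr_fun h i) j
  rw [Matrix.map_apply, Matrix.map_apply, eq_intCast, eq_intCast] at hij
  exact (ZMod.intCast_eq_intCast_iff _ _ 2).mp hij

variable {n : ℕ}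

/-- ★★ **The normal forms `u(S)`, `u(S′)` (`S, S′` symmetric) are `Sp_{2n}(ℤ)`-conjugate iff `S̄, S̄′` have the
same rank and the same alternation type** — «`Sp_{2n}(ℤ)`-conjugacy classes of involutions with multiplier `−1`
… correspond to … congruence classes of symmetric `n × n` matrices `B` consisting of zeroes and ones», the
latter being classified by (rank, alternation) [Albert].  (⟸: Albert's classification over `𝔽₂` lifted to
`SL_n(ℤ)` and the conjugations `δ(A)`, `n(T)` of the proof of Lemma 45; ⟹: the invariants of §2.)
[cite: GoreskyTai2017RealStructuresOrdinary, App. §20.6 Proposition 50 (proof) with §19.2 Lemma 45; Albert1938, Thms. 3, 7] -/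
theorem upperInvolution_conj_iff (S S' : Matrix (Fin n) (Fin n) ℤ) (hS : Sᵀ = S) (hS' : S'ᵀ = S') :
    (∃ g g' : Matrix (Fin n ⊕ Fin n) (Fin n ⊕ Fin n) ℤ, g ∈ Matrix.symplecticGroup (Fin n) ℤ ∧ g * g' = 1 ∧
        g * fromBlocks (1 : Matrix (Fin n) (Fin n) ℤ) S 0 (-1 : Matrix (Fin n) (Fin n) ℤ) * g' =
          fromBlocks (1 : Matrix (Fin n) (Fin n) ℤ) S' 0 (-1 : Matrix (Fin n) (Fin n) ℤ)) ↔
      (S.map (Int.castRingHom (ZMod 2))).rank = (S'.map (Int.castRingHom (ZMod 2))).rank ∧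
        ((∀ i, (2 : ℤ) ∣ S i i) ↔ ∀ i, (2 : ℤ) ∣ S' i i) := by
  constructor
  · rintro ⟨g, g', hg, hgg', hconj⟩
    refine ⟨?_, ?_⟩
    · rw [← rank_map_upperInvolution_sub_one S, ← rank_map_upperInvolution_sub_one S', ← hconj,
        rank_map_conj_sub_one _ hgg']
    · rw [← forall_two_dvd_diag_J_mul_upperInvolution_iff S, ← forall_two_dvd_diag_J_mul_upperInvolution_iff S',
        ← hconj, forall_two_dvd_diag_J_mul_conj_iff _ (upperInvolution_mul_self S)
          ((transpose_upperInvolution_mul_J_mul_eq_neg_J_iff S).2 hS) hg hgg']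
  · rintro ⟨hr, hd⟩
    obtain ⟨a, ha⟩ := (exists_sl_intModEq_congr_iff_type_eq S S' hS hS').2 ⟨hr, hd⟩
    have hP : ((Matrix.SpecialLinearGroup.map (Int.castRingHom (ZMod 2)) a :
        Matrix.SpecialLinearGroup (Fin n) (ZMod 2)) : Matrix (Fin n) (Fin n) (ZMod 2))ᵀ *
        S.map (Int.castRingHom (ZMod 2)) * (Matrix.SpecialLinearGroup.map (Int.castRingHom (ZMod 2)) a :
          Matrix.SpecialLinearGroup (Fin n) (ZMod 2)) = S'.map (Int.castRingHom (ZMod 2)) := by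
      have e : ((Matrix.SpecialLinearGroup.map (Int.castRingHom (ZMod 2)) a :
          Matrix.SpecialLinearGroup (Fin n) (ZMod 2)) : Matrix (Fin n) (Fin n) (ZMod 2)) =
          (a : Matrix (Fin n) (Fin n) ℤ).map (Int.castRingHom (ZMod 2)) := rfl
      rw [e, ← transpose_map, ← Matrix.map_mul, ← Matrix.map_mul]
      exact map_eq_map_of_forall_intModEq ha
    exact exists_symplectic_conj_upperInvolution_of_congruent_mod_two S S' hS hS' _ hP

/-- **… iff `S, S′` are `GL_n(ℤ)`-congruent modulo `2`** («`GL_n(ℤ)`-congruence classes of symmetric `n × n`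
matrices `B` consisting of zeroes and ones»). [cite: GoreskyTai2017RealStructuresOrdinary, App. §20.6
Proposition 50 (proof); Silhol1989, Ch. IV (4.2)–(4.3)] -/
theorem upperInvolution_conj_iff_exists_gl_congr (S S' : Matrix (Fin n) (Fin n) ℤ) (hS : Sᵀ = S) (hS' : S'ᵀ = S') :
    (∃ g g' : Matrix (Fin n ⊕ Fin n) (Fin n ⊕ Fin n) ℤ, g ∈ Matrix.symplecticGroup (Fin n) ℤ ∧ g * g' = 1 ∧
        g * fromBlocks (1 : Matrix (Fin n) (Fin n) ℤ) S 0 (-1 : Matrix (Fin n) (Fin n) ℤ) * g' =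
          fromBlocks (1 : Matrix (Fin n) (Fin n) ℤ) S' 0 (-1 : Matrix (Fin n) (Fin n) ℤ)) ↔
      ∃ a a' : Matrix (Fin n) (Fin n) ℤ, a * a' = 1 ∧ ∀ i j, (aᵀ * S * a) i j ≡ S' i j [ZMOD 2] := by
  rw [upperInvolution_conj_iff S S' hS hS', exists_gl_intModEq_congr_iff_type_eq S S' hS hS']

/-- ★★ **A complete `Sp_{2n}(ℤ)`-conjugacy invariant.**  Two integral involutions `τ₁, τ₂` of multiplier `−1`
are `Sp_{2n}(ℤ)`-conjugate iff `rank(τ̄₁ − 1) = rank(τ̄₂ − 1)` over `𝔽₂` and the diagonals of `Jτ₁`, `Jτ₂`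
have the same parity type (both even, or both with an odd entry).  (Lemma 45 conjugates `τᵢ` to `u(Bᵢ)`;
then `upperInvolution_conj_iff`.) [cite: GoreskyTai2017RealStructuresOrdinary, App. §20.6 Proposition 50
(proof) with §19.2 Lemma 45; Albert1938, Thms. 3, 7] -/
theorem conj_iff_invariants_eq (τ₁ τ₂ : Matrix (Fin n ⊕ Fin n) (Fin n ⊕ Fin n) ℤ) (h₁ : τ₁ * τ₁ = 1)
    (hJ₁ : τ₁ᵀ * Matrix.J (Fin n) ℤ * τ₁ = -Matrix.J (Fin n) ℤ) (h₂ : τ₂ * τ₂ = 1)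
    (hJ₂ : τ₂ᵀ * Matrix.J (Fin n) ℤ * τ₂ = -Matrix.J (Fin n) ℤ) :
    (∃ g g' : Matrix (Fin n ⊕ Fin n) (Fin n ⊕ Fin n) ℤ, g ∈ Matrix.symplecticGroup (Fin n) ℤ ∧ g * g' = 1 ∧
        g * τ₁ * g' = τ₂) ↔
      (τ₁.map (Int.castRingHom (ZMod 2)) - 1).rank = (τ₂.map (Int.castRingHom (ZMod 2)) - 1).rank ∧
        ((∀ i, (2 : ℤ) ∣ (Matrix.J (Fin n) ℤ * τ₁) i i) ↔ ∀ i, (2 : ℤ) ∣ (Matrix.J (Fin n) ℤ * τ₂) i i) := by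
  constructor
  · rintro ⟨g, g', hg, hgg', rfl⟩
    exact ⟨(rank_map_conj_sub_one τ₁ hgg').symm, (forall_two_dvd_diag_J_mul_conj_iff τ₁ h₁ hJ₁ hg hgg').symm⟩
  · rintro ⟨hr, hd⟩
    obtain ⟨B₁, hB₁, k₁⟩ := exists_conj_upperInvolution τ₁ h₁ hJ₁
    obtain ⟨B₂, hB₂, k₂⟩ := exists_conj_upperInvolution τ₂ h₂ hJ₂
    have hr' : (B₁.map (Int.castRingHom (ZMod 2))).rank = (B₂.map (Int.castRingHom (ZMod 2))).rank := by
      obtain ⟨g, g', hg, hgg', hc⟩ := k₁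
      obtain ⟨k, k', hk, hkk', hc'⟩ := k₂
      rw [← rank_map_upperInvolution_sub_one B₁, ← rank_map_upperInvolution_sub_one B₂, ← hc, ← hc',
        rank_map_conj_sub_one _ hgg', rank_map_conj_sub_one _ hkk', hr]
    have hd' : (∀ i, (2 : ℤ) ∣ B₁ i i) ↔ ∀ i, (2 : ℤ) ∣ B₂ i i := by
      obtain ⟨g, g', hg, hgg', hc⟩ := k₁
      obtain ⟨k, k', hk, hkk', hc'⟩ := k₂
      rw [← forall_two_dvd_diag_J_mul_upperInvolution_iff B₁, ← forall_two_dvd_diag_J_mul_upperInvolution_iff B₂,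
        ← hc, ← hc', forall_two_dvd_diag_J_mul_conj_iff _ h₁ hJ₁ hg hgg',
        forall_two_dvd_diag_J_mul_conj_iff _ h₂ hJ₂ hk hkk', hd]
    have hu := (upperInvolution_conj_iff B₁ B₂ hB₁ hB₂).2 ⟨hr', hd'⟩
    exact conj_trans (conj_trans k₁ hu) (conj_symm k₂)

/-! ## §4 The number of `Sp_{2n}(ℤ)`-conjugacy classes: `n + 1 + ⌊n/2⌋` -/

/-- The symmetric `0/1` lift of a symmetric matrix over `𝔽₂` («symmetric … matrices `B` consisting of zeroes and
ones»). [cite: GoreskyTai2017RealStructuresOrdinary, App. §19.2 Lemma 45 and §20.6 Proposition 50 (proof)] -/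
theorem exists_symm_map_eq (N : Matrix (Fin n) (Fin n) (ZMod 2)) (hN : Nᵀ = N) :
    ∃ S : Matrix (Fin n) (Fin n) ℤ, Sᵀ = S ∧ S.map (Int.castRingHom (ZMod 2)) = N := by
  refine ⟨N.map (fun x => ((ZMod.val x : ℕ) : ℤ)), ?_, ?_⟩
  · rw [← transpose_map, hN]
  · ext i j
    simp only [Matrix.map_apply, eq_intCast, Int.cast_natCast, ZMod.natCast_zmod_val]

/-- ★★★ **Goresky–Tai 2017, Proposition 50 (third assertion) for `Sp_{2n}(ℤ)`: the number of
`Sp_{2n}(ℤ)`-conjugacy classes of integral involutions of multiplier `−1` is `n + 1 + ⌊n/2⌋`** — «Summing over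
the possible ranks `0 ≤ r ≤ n` for the matrix `B`, with two possibilities when `r` is even and only one
possibility when `r` is odd».  The classes are taken as subsets of `M_{2n}(ℤ)`; the bijection with the types
`(rank B̄, [B̄ non-alternate])` is `conj_iff_invariants_eq`, and the types are counted by the tree's
`QuadraticForm.ncard_congruenceTypes` (Silhol IV (5.2)).
[cite: GoreskyTai2017RealStructuresOrdinary, App. §20.6 Proposition 50 and proof; Silhol1989, Ch. IV Prop. (5.2)] -/
theorem ncard_conjClasses (n : ℕ) :
    {C : Set (Matrix (Fin n ⊕ Fin n) (Fin n ⊕ Fin n) ℤ) |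
        ∃ τ : Matrix (Fin n ⊕ Fin n) (Fin n ⊕ Fin n) ℤ, τ * τ = 1 ∧
          τᵀ * Matrix.J (Fin n) ℤ * τ = -Matrix.J (Fin n) ℤ ∧
          C = {σ | ∃ g g' : Matrix (Fin n ⊕ Fin n) (Fin n ⊕ Fin n) ℤ,
            g ∈ Matrix.symplecticGroup (Fin n) ℤ ∧ g * g' = 1 ∧ g * τ * g' = σ}}.ncard = n + 1 + n / 2 := by
  classical
  rw [← QuadraticForm.ncard_congruenceTypes n]
  -- the type of an involution: (`rank(τ̄ − 1)`, [the diagonal of `Jτ` has an odd entry])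
  let ty : Matrix (Fin n ⊕ Fin n) (Fin n ⊕ Fin n) ℤ → ℕ × Bool := fun τ =>
    ((τ.map (Int.castRingHom (ZMod 2)) - 1).rank, decide (¬ ∀ i, (2 : ℤ) ∣ (Matrix.J (Fin n) ℤ * τ) i i))
  have ty_eq_iff : ∀ τ₁ τ₂ : Matrix (Fin n ⊕ Fin n) (Fin n ⊕ Fin n) ℤ, ty τ₁ = ty τ₂ ↔
      ((τ₁.map (Int.castRingHom (ZMod 2)) - 1).rank = (τ₂.map (Int.castRingHom (ZMod 2)) - 1).rank ∧
        ((∀ i, (2 : ℤ) ∣ (Matrix.J (Fin n) ℤ * τ₁) i i) ↔ ∀ i, (2 : ℤ) ∣ (Matrix.J (Fin n) ℤ * τ₂) i i)) := by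
    intro τ₁ τ₂
    simp only [ty, Prod.mk.injEq, and_congr_right_iff]
    intro _
    rw [decide_eq_decide, not_iff_not]
  -- the type of `u(S)`
  have ty_upper : ∀ S : Matrix (Fin n) (Fin n) ℤ, ty (fromBlocks (1 : Matrix (Fin n) (Fin n) ℤ) S 0 (-1)) =
      ((S.map (Int.castRingHom (ZMod 2))).rank, decide (∃ i, S.map (Int.castRingHom (ZMod 2)) i i ≠ 0)) := by
    intro S
    simp only [ty, Prod.mk.injEq]
    refine ⟨rank_map_upperInvolution_sub_one S, ?_⟩
    rw [decide_eq_decide, forall_two_dvd_diag_J_mul_upperInvolution_iff, not_forall]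
    simp only [ne_eq, map_apply_eq_zero_iff]
  refine Set.ncard_congr (fun C hC => ty (Exists.choose hC)) ?_ ?_ ?_
  · -- the type of a class is a realised type
    intro C hC
    obtain ⟨hτ, hJτ, -⟩ := Exists.choose_spec hC
    obtain ⟨B, hB, k⟩ := exists_conj_upperInvolution (Exists.choose hC) hτ hJτ
    have e : ty (Exists.choose hC) = ty (fromBlocks (1 : Matrix (Fin n) (Fin n) ℤ) B 0 (-1)) :=
      (ty_eq_iff _ _).2 ((conj_iff_invariants_eq _ _ hτ hJτ (upperInvolution_mul_self B)
        ((transpose_upperInvolution_mul_J_mul_eq_neg_J_iff B).2 hB)).1 k)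
    show ty (Exists.choose hC) ∈ _
    rw [e, ty_upper]
    exact ⟨B.map (Int.castRingHom (ZMod 2)), by rw [← transpose_map, hB], rfl, decide_eq_true_iff.symm⟩
  · -- injective: equal types ⟹ conjugate representatives ⟹ equal classes
    intro C₁ C₂ hC₁ hC₂ hty
    change ty (Exists.choose hC₁) = ty (Exists.choose hC₂) at hty
    obtain ⟨hσ₁, hJσ₁, e₁⟩ := Exists.choose_spec hC₁
    obtain ⟨hσ₂, hJσ₂, e₂⟩ := Exists.choose_spec hC₂
    rw [e₁, e₂]
    exact conjClass_eq_of_conj ((conj_iff_invariants_eq _ _ hσ₁ hJσ₁ hσ₂ hJσ₂).2 ((ty_eq_iff _ _).1 hty))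
  · -- surjective: every type is the type of some `u(S)`
    rintro t ⟨N, hN, hr, hd⟩
    obtain ⟨S, hS, hSN⟩ := exists_symm_map_eq N hN
    have hu1 := upperInvolution_mul_self (R := ℤ) S
    have hu2 := (transpose_upperInvolution_mul_J_mul_eq_neg_J_iff S).2 hS
    refine ⟨_, ⟨_, hu1, hu2, rfl⟩, ?_⟩
    -- the value does not depend on the membership proof: compute it from `choose_spec`
    suffices key : ∀ hC : {σ | ∃ g g' : Matrix (Fin n ⊕ Fin n) (Fin n ⊕ Fin n) ℤ,
        g ∈ Matrix.symplecticGroup (Fin n) ℤ ∧ g * g' = 1 ∧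
          g * fromBlocks (1 : Matrix (Fin n) (Fin n) ℤ) S 0 (-1 : Matrix (Fin n) (Fin n) ℤ) * g' = σ} ∈
        {C : Set (Matrix (Fin n ⊕ Fin n) (Fin n ⊕ Fin n) ℤ) |
          ∃ τ : Matrix (Fin n ⊕ Fin n) (Fin n ⊕ Fin n) ℤ, τ * τ = 1 ∧
            τᵀ * Matrix.J (Fin n) ℤ * τ = -Matrix.J (Fin n) ℤ ∧
            C = {σ | ∃ g g' : Matrix (Fin n ⊕ Fin n) (Fin n ⊕ Fin n) ℤ,
              g ∈ Matrix.symplecticGroup (Fin n) ℤ ∧ g * g' = 1 ∧ g * τ * g' = σ}},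
        ty (Exists.choose hC) = t from key _
    intro hC
    obtain ⟨hσ, hJσ, e⟩ := Exists.choose_spec hC
    -- `u(S)` lies in its own class, which is the class of the chosen representative
    have hmem : fromBlocks (1 : Matrix (Fin n) (Fin n) ℤ) S 0 (-1 : Matrix (Fin n) (Fin n) ℤ) ∈
        {σ | ∃ g g' : Matrix (Fin n ⊕ Fin n) (Fin n ⊕ Fin n) ℤ, g ∈ Matrix.symplecticGroup (Fin n) ℤ ∧
            g * g' = 1 ∧ g * Exists.choose hC * g' = σ} := by
      rw [← e]
      exact conj_refl _
    have ety : ty (Exists.choose hC) = ty (fromBlocks (1 : Matrix (Fin n) (Fin n) ℤ) S 0 (-1)) :=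
      (ty_eq_iff _ _).2 ((conj_iff_invariants_eq _ _ hσ hJσ hu1 hu2).1 hmem)
    rw [ety, ty_upper, hSN, hr]
    obtain ⟨t1, t2⟩ := t
    simp only [Prod.mk.injEq, true_and]
    cases t2
    · simpa using hd
    · simpa using hd

/-- **The printed numbers**: `n + 1 + ⌊n/2⌋` is «`(3n+1)/2` if `n` is odd, or `(3n+2)/2` if `n` is even».
[cite: GoreskyTai2017RealStructuresOrdinary, App. §20.6 Proposition 50] -/
theorem ncard_conjClasses_eq_printed (n : ℕ) :
    {C : Set (Matrix (Fin n ⊕ Fin n) (Fin n ⊕ Fin n) ℤ) |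
        ∃ τ : Matrix (Fin n ⊕ Fin n) (Fin n ⊕ Fin n) ℤ, τ * τ = 1 ∧
          τᵀ * Matrix.J (Fin n) ℤ * τ = -Matrix.J (Fin n) ℤ ∧
          C = {σ | ∃ g g' : Matrix (Fin n ⊕ Fin n) (Fin n ⊕ Fin n) ℤ,
            g ∈ Matrix.symplecticGroup (Fin n) ℤ ∧ g * g' = 1 ∧ g * τ * g' = σ}}.ncard =
      if Odd n then (3 * n + 1) / 2 else (3 * n + 2) / 2 := by
  rw [ncard_conjClasses]
  split_ifs with h
  · obtain ⟨k, rfl⟩ := h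
    omega
  · obtain ⟨k, rfl⟩ := Nat.not_odd_iff_even.1 h
    omega

/-! ## §5 The dictionary with `H¹(⟨τ₀⟩, Sp_{2n}(ℤ))` (`τ₀ = (−1 0; 0 1)`, `g̃ = τ₀gτ₀`) -/

/-- `τ₀² = 1`. [cite: GoreskyTai2017RealStructuresOrdinary, App. §19.1 («the standard involution `τ₀`»)] -/
theorem tau0_mul_tau0 :
    fromBlocks (-1 : Matrix m m ℤ) 0 0 (1 : Matrix m m ℤ) * fromBlocks (-1 : Matrix m m ℤ) 0 0 (1 : Matrix m m ℤ) = 1 := by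
  rw [fromBlocks_multiply, ← fromBlocks_one]
  simp

/-- `τ₀(τ₀X) = X`. [folklore] -/
private theorem tau0_mul_tau0_mul {k : Type*} (X : Matrix (m ⊕ m) k ℤ) :
    fromBlocks (-1 : Matrix m m ℤ) 0 0 (1 : Matrix m m ℤ) * (fromBlocks (-1 : Matrix m m ℤ) 0 0 (1 : Matrix m m ℤ) * X) = X := by
  rw [← Matrix.mul_assoc, tau0_mul_tau0, Matrix.one_mul]

omit [Fintype m] in
/-- `ᵗτ₀ = τ₀` (`τ₀` is diagonal). [cite: GoreskyTai2017RealStructuresOrdinary, App. §19.1 («The standard involution `τ₀`»)] -/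
theorem transpose_tau0 :
    (fromBlocks (-1 : Matrix m m ℤ) 0 0 (1 : Matrix m m ℤ))ᵀ = fromBlocks (-1 : Matrix m m ℤ) 0 0 (1 : Matrix m m ℤ) := by
  rw [fromBlocks_transpose]
  simp

/-- **`τ₀` has multiplier `−1`**: `τ₀Jτ₀ = −J`. [cite: GoreskyTai2017RealStructuresOrdinary, App. §19.1] -/
theorem tau0_mul_J_mul_tau0 :
    fromBlocks (-1 : Matrix m m ℤ) 0 0 (1 : Matrix m m ℤ) * Matrix.J m ℤ * fromBlocks (-1 : Matrix m m ℤ) 0 0 (1 : Matrix m m ℤ) =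
      -Matrix.J m ℤ := by
  rw [Matrix.J, fromBlocks_multiply, fromBlocks_multiply, fromBlocks_neg]
  simp

/-- `τ₀Xτ₀ = −J ⟺ X = J` (`τ₀² = 1`, `τ₀Jτ₀ = −J`). [cite: GoreskyTai2017RealStructuresOrdinary, App. §19.1 («The standard involution `τ₀`», multiplier `−1`)] -/
theorem tau0_mul_mul_tau0_eq_neg_J_iff (X : Matrix (m ⊕ m) (m ⊕ m) ℤ) :
    fromBlocks (-1 : Matrix m m ℤ) 0 0 (1 : Matrix m m ℤ) * X * fromBlocks (-1 : Matrix m m ℤ) 0 0 (1 : Matrix m m ℤ) =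
      -Matrix.J m ℤ ↔ X = Matrix.J m ℤ := by
  constructor
  · intro h
    calc X = fromBlocks (-1 : Matrix m m ℤ) 0 0 (1 : Matrix m m ℤ) *
          (fromBlocks (-1 : Matrix m m ℤ) 0 0 (1 : Matrix m m ℤ) * X * fromBlocks (-1 : Matrix m m ℤ) 0 0 (1 : Matrix m m ℤ)) *
          fromBlocks (-1 : Matrix m m ℤ) 0 0 (1 : Matrix m m ℤ) := by
            simp only [Matrix.mul_assoc, tau0_mul_tau0_mul, tau0_mul_tau0, Matrix.mul_one]
      _ = Matrix.J m ℤ := by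
            rw [h, Matrix.mul_neg, Matrix.neg_mul, tau0_mul_J_mul_tau0, neg_neg]
  · rintro rfl
    exact tau0_mul_J_mul_tau0

/-- **`Sp_{2n}(ℤ)` is stable under `h ↦ h̃ = τ₀hτ₀`** («`Γ̃ = Γ`»). [cite: GoreskyTai2017RealStructuresOrdinary, App. §20.1] -/
theorem tau0_conj_mem_symplecticGroup {h : Matrix (m ⊕ m) (m ⊕ m) ℤ} (hh : h ∈ Matrix.symplecticGroup m ℤ) :
    fromBlocks (-1 : Matrix m m ℤ) 0 0 (1 : Matrix m m ℤ) * h * fromBlocks (-1 : Matrix m m ℤ) 0 0 (1 : Matrix m m ℤ) ∈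
      Matrix.symplecticGroup m ℤ := by
  rw [SymplecticGroup.mem_iff'] at hh ⊢
  rw [transpose_mul, transpose_mul, transpose_tau0]
  calc fromBlocks (-1 : Matrix m m ℤ) 0 0 (1 : Matrix m m ℤ) * (hᵀ * fromBlocks (-1 : Matrix m m ℤ) 0 0 (1 : Matrix m m ℤ)) *
        Matrix.J m ℤ * (fromBlocks (-1 : Matrix m m ℤ) 0 0 (1 : Matrix m m ℤ) * h * fromBlocks (-1 : Matrix m m ℤ) 0 0 (1 : Matrix m m ℤ))
        = fromBlocks (-1 : Matrix m m ℤ) 0 0 (1 : Matrix m m ℤ) * hᵀ *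
          (fromBlocks (-1 : Matrix m m ℤ) 0 0 (1 : Matrix m m ℤ) * Matrix.J m ℤ * fromBlocks (-1 : Matrix m m ℤ) 0 0 (1 : Matrix m m ℤ)) *
          h * fromBlocks (-1 : Matrix m m ℤ) 0 0 (1 : Matrix m m ℤ) := by simp only [Matrix.mul_assoc]
    _ = -(fromBlocks (-1 : Matrix m m ℤ) 0 0 (1 : Matrix m m ℤ) * (hᵀ * Matrix.J m ℤ * h) *
          fromBlocks (-1 : Matrix m m ℤ) 0 0 (1 : Matrix m m ℤ)) := by
          rw [tau0_mul_J_mul_tau0]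
          simp only [Matrix.mul_neg, Matrix.neg_mul, Matrix.mul_assoc]
    _ = Matrix.J m ℤ := by rw [hh, tau0_mul_J_mul_tau0, neg_neg]

/-- **«`g = ττ₀` defines a cocycle since `gg̃ = 1`»**: for `τ = gτ₀`, `τ² = 1 ⟺ g·(τ₀gτ₀) = 1`.
[cite: GoreskyTai2017RealStructuresOrdinary, App. §20.1 (before Proposition 47)] -/
theorem mul_tau0_mul_self_eq_one_iff (g : Matrix (m ⊕ m) (m ⊕ m) ℤ) :
    g * fromBlocks (-1 : Matrix m m ℤ) 0 0 (1 : Matrix m m ℤ) * (g * fromBlocks (-1 : Matrix m m ℤ) 0 0 (1 : Matrix m m ℤ)) = 1 ↔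
      g * (fromBlocks (-1 : Matrix m m ℤ) 0 0 (1 : Matrix m m ℤ) * g * fromBlocks (-1 : Matrix m m ℤ) 0 0 (1 : Matrix m m ℤ)) = 1 := by
  rw [show g * fromBlocks (-1 : Matrix m m ℤ) 0 0 (1 : Matrix m m ℤ) * (g * fromBlocks (-1 : Matrix m m ℤ) 0 0 (1 : Matrix m m ℤ)) =
      g * (fromBlocks (-1 : Matrix m m ℤ) 0 0 (1 : Matrix m m ℤ) * g * fromBlocks (-1 : Matrix m m ℤ) 0 0 (1 : Matrix m m ℤ)) by
    simp only [Matrix.mul_assoc]]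

/-- **`τ = gτ₀` has multiplier `−1` iff `g ∈ Sp_{2n}(ℤ)`** (the involutions of multiplier `−1` are exactly the
coset `Sp_{2n}(ℤ)·τ₀`). [cite: GoreskyTai2017RealStructuresOrdinary, App. §20.1 Proposition 47 («`τ ∈ Γ.τ₀`»)] -/
theorem mul_tau0_multiplier_iff (g : Matrix (m ⊕ m) (m ⊕ m) ℤ) :
    (g * fromBlocks (-1 : Matrix m m ℤ) 0 0 (1 : Matrix m m ℤ))ᵀ * Matrix.J m ℤ *
        (g * fromBlocks (-1 : Matrix m m ℤ) 0 0 (1 : Matrix m m ℤ)) = -Matrix.J m ℤ ↔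
      g ∈ Matrix.symplecticGroup m ℤ := by
  rw [SymplecticGroup.mem_iff', transpose_mul, transpose_tau0,
    show fromBlocks (-1 : Matrix m m ℤ) 0 0 (1 : Matrix m m ℤ) * gᵀ * Matrix.J m ℤ * (g * fromBlocks (-1 : Matrix m m ℤ) 0 0 (1 : Matrix m m ℤ)) =
      fromBlocks (-1 : Matrix m m ℤ) 0 0 (1 : Matrix m m ℤ) * (gᵀ * Matrix.J m ℤ * g) * fromBlocks (-1 : Matrix m m ℤ) 0 0 (1 : Matrix m m ℤ) by
        simp only [Matrix.mul_assoc]]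
  exact tau0_mul_mul_tau0_eq_neg_J_iff _

/-- Right multiplication by `τ₀` is injective (`τ₀² = 1`). [folklore] -/
private theorem mul_tau0_injective :
    Function.Injective fun x : Matrix (m ⊕ m) (m ⊕ m) ℤ => x * fromBlocks (-1 : Matrix m m ℤ) 0 0 (1 : Matrix m m ℤ) := by
  intro x y h
  have h' := congrArg (fun z : Matrix (m ⊕ m) (m ⊕ m) ℤ => z * fromBlocks (-1 : Matrix m m ℤ) 0 0 (1 : Matrix m m ℤ)) h
  simpa only [Matrix.mul_assoc, tau0_mul_tau0, Matrix.mul_one] using h'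

/-- **The cohomology class of the cocycle `g` is the conjugacy class of the involution `gτ₀`, translated by
`τ₀`**: `{h̃gh⁻¹ | h ∈ Sp_{2n}(ℤ)} = {kgτ₀k⁻¹ | k ∈ Sp_{2n}(ℤ)}·τ₀` (`k = h̃`).
[cite: GoreskyTai2017RealStructuresOrdinary, App. §20.1 Proposition 47 («The mapping `τ ↦ ττ₀` determines a one
to one correspondence …»)] -/
theorem cohomologyClass_eq_image_conjClass (g : Matrix (m ⊕ m) (m ⊕ m) ℤ) :
    {g' : Matrix (m ⊕ m) (m ⊕ m) ℤ | ∃ h h' : Matrix (m ⊕ m) (m ⊕ m) ℤ, h ∈ Matrix.symplecticGroup m ℤ ∧ h * h' = 1 ∧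
        fromBlocks (-1 : Matrix m m ℤ) 0 0 (1 : Matrix m m ℤ) * h * fromBlocks (-1 : Matrix m m ℤ) 0 0 (1 : Matrix m m ℤ) * g * h' = g'} =
      (fun x : Matrix (m ⊕ m) (m ⊕ m) ℤ => x * fromBlocks (-1 : Matrix m m ℤ) 0 0 (1 : Matrix m m ℤ)) ''
        {σ | ∃ k k' : Matrix (m ⊕ m) (m ⊕ m) ℤ, k ∈ Matrix.symplecticGroup m ℤ ∧ k * k' = 1 ∧
          k * (g * fromBlocks (-1 : Matrix m m ℤ) 0 0 (1 : Matrix m m ℤ)) * k' = σ} := by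
  ext g'
  simp only [Set.mem_setOf_eq, Set.mem_image]
  constructor
  · rintro ⟨h, h', hh, hhh', rfl⟩
    refine ⟨_, ⟨fromBlocks (-1 : Matrix m m ℤ) 0 0 (1 : Matrix m m ℤ) * h * fromBlocks (-1 : Matrix m m ℤ) 0 0 (1 : Matrix m m ℤ),
      fromBlocks (-1 : Matrix m m ℤ) 0 0 (1 : Matrix m m ℤ) * h' * fromBlocks (-1 : Matrix m m ℤ) 0 0 (1 : Matrix m m ℤ),
      tau0_conj_mem_symplecticGroup hh, ?_, rfl⟩, ?_⟩
    · calc fromBlocks (-1 : Matrix m m ℤ) 0 0 (1 : Matrix m m ℤ) * h * fromBlocks (-1 : Matrix m m ℤ) 0 0 (1 : Matrix m m ℤ) *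
            (fromBlocks (-1 : Matrix m m ℤ) 0 0 (1 : Matrix m m ℤ) * h' * fromBlocks (-1 : Matrix m m ℤ) 0 0 (1 : Matrix m m ℤ))
            = fromBlocks (-1 : Matrix m m ℤ) 0 0 (1 : Matrix m m ℤ) * (h * h') * fromBlocks (-1 : Matrix m m ℤ) 0 0 (1 : Matrix m m ℤ) := by
              simp only [Matrix.mul_assoc, tau0_mul_tau0_mul]
        _ = 1 := by rw [hhh', Matrix.mul_one, tau0_mul_tau0]
    · simp only [Matrix.mul_assoc, tau0_mul_tau0_mul, tau0_mul_tau0, Matrix.mul_one]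
  · rintro ⟨σ, ⟨k, k', hk, hkk', rfl⟩, rfl⟩
    refine ⟨fromBlocks (-1 : Matrix m m ℤ) 0 0 (1 : Matrix m m ℤ) * k * fromBlocks (-1 : Matrix m m ℤ) 0 0 (1 : Matrix m m ℤ),
      fromBlocks (-1 : Matrix m m ℤ) 0 0 (1 : Matrix m m ℤ) * k' * fromBlocks (-1 : Matrix m m ℤ) 0 0 (1 : Matrix m m ℤ),
      tau0_conj_mem_symplecticGroup hk, ?_, ?_⟩
    · calc fromBlocks (-1 : Matrix m m ℤ) 0 0 (1 : Matrix m m ℤ) * k * fromBlocks (-1 : Matrix m m ℤ) 0 0 (1 : Matrix m m ℤ) *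
            (fromBlocks (-1 : Matrix m m ℤ) 0 0 (1 : Matrix m m ℤ) * k' * fromBlocks (-1 : Matrix m m ℤ) 0 0 (1 : Matrix m m ℤ))
            = fromBlocks (-1 : Matrix m m ℤ) 0 0 (1 : Matrix m m ℤ) * (k * k') * fromBlocks (-1 : Matrix m m ℤ) 0 0 (1 : Matrix m m ℤ) := by
              simp only [Matrix.mul_assoc, tau0_mul_tau0_mul]
        _ = 1 := by rw [hkk', Matrix.mul_one, tau0_mul_tau0]
    · simp only [Matrix.mul_assoc, tau0_mul_tau0_mul, tau0_mul_tau0, Matrix.mul_one]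

/-- ★★★ **Goresky–Tai 2017, Proposition 50 (third assertion): `H¹(⟨τ₀⟩, Sp_{2n}(ℤ))` has `n + 1 + ⌊n/2⌋` elements**
— «`(3n+1)/2` if `n` is odd, or `(3n+2)/2` if `n` is even».  The cohomology set is realised as the set of classes
`{h̃gh′ | h ∈ Sp_{2n}(ℤ), hh′ = 1}` (`h̃ = τ₀hτ₀`, «`g′ = h̃gh⁻¹`») of the cocycles `g ∈ Sp_{2n}(ℤ)`, `gg̃ = 1`; by
Proposition 47 (`cohomologyClass_eq_image_conjClass`) these are the conjugacy classes of `ncard_conjClasses`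
translated by `τ₀`. [cite: GoreskyTai2017RealStructuresOrdinary, App. §20.6 Proposition 50 and proof («it may be
identified with `Sp_{2n}(ℤ)`-conjugacy classes of involutions with multiplier `−1`»); App. §20.1 Proposition 47] -/
theorem ncard_cohomologyClasses (n : ℕ) :
    {C : Set (Matrix (Fin n ⊕ Fin n) (Fin n ⊕ Fin n) ℤ) |
        ∃ g : Matrix (Fin n ⊕ Fin n) (Fin n ⊕ Fin n) ℤ, g ∈ Matrix.symplecticGroup (Fin n) ℤ ∧
          g * (fromBlocks (-1 : Matrix (Fin n) (Fin n) ℤ) 0 0 (1 : Matrix (Fin n) (Fin n) ℤ) * g *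
            fromBlocks (-1 : Matrix (Fin n) (Fin n) ℤ) 0 0 (1 : Matrix (Fin n) (Fin n) ℤ)) = 1 ∧
          C = {g' | ∃ h h' : Matrix (Fin n ⊕ Fin n) (Fin n ⊕ Fin n) ℤ, h ∈ Matrix.symplecticGroup (Fin n) ℤ ∧ h * h' = 1 ∧
            fromBlocks (-1 : Matrix (Fin n) (Fin n) ℤ) 0 0 (1 : Matrix (Fin n) (Fin n) ℤ) * h *
              fromBlocks (-1 : Matrix (Fin n) (Fin n) ℤ) 0 0 (1 : Matrix (Fin n) (Fin n) ℤ) * g * h' = g'}}.ncard =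
      n + 1 + n / 2 := by
  rw [← ncard_conjClasses n]
  have hΦ : Function.Injective fun C : Set (Matrix (Fin n ⊕ Fin n) (Fin n ⊕ Fin n) ℤ) =>
      (fun x : Matrix (Fin n ⊕ Fin n) (Fin n ⊕ Fin n) ℤ =>
        x * fromBlocks (-1 : Matrix (Fin n) (Fin n) ℤ) 0 0 (1 : Matrix (Fin n) (Fin n) ℤ)) '' C :=
    Set.image_injective.2 mul_tau0_injective
  conv_rhs => rw [← Set.ncard_image_of_injective _ hΦ]
  congr 1
  ext C
  constructor
  · rintro ⟨g, hg, hcoc, rfl⟩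
    exact ⟨_, ⟨g * fromBlocks (-1 : Matrix (Fin n) (Fin n) ℤ) 0 0 (1 : Matrix (Fin n) (Fin n) ℤ),
      (mul_tau0_mul_self_eq_one_iff g).2 hcoc, (mul_tau0_multiplier_iff g).2 hg, rfl⟩,
      (cohomologyClass_eq_image_conjClass g).symm⟩
  · rintro ⟨C', ⟨τ, hτ, hJτ, rfl⟩, rfl⟩
    have hτ' : τ * fromBlocks (-1 : Matrix (Fin n) (Fin n) ℤ) 0 0 (1 : Matrix (Fin n) (Fin n) ℤ) *
        fromBlocks (-1 : Matrix (Fin n) (Fin n) ℤ) 0 0 (1 : Matrix (Fin n) (Fin n) ℤ) = τ := by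
      rw [Matrix.mul_assoc, tau0_mul_tau0, Matrix.mul_one]
    refine ⟨τ * fromBlocks (-1 : Matrix (Fin n) (Fin n) ℤ) 0 0 (1 : Matrix (Fin n) (Fin n) ℤ), ?_, ?_, ?_⟩
    · rw [← mul_tau0_multiplier_iff, hτ']
      exact hJτ
    · rw [← mul_tau0_mul_self_eq_one_iff, hτ']
      exact hτ
    · rw [cohomologyClass_eq_image_conjClass, hτ']

end ModTwo

end IntegerSymplecticInvolution

end Literature.LinearAlgebra.Matrix
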